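import Summits.HodgeConjecture.HodgeConjecture.Theorems.AnchorTransportVariationalHodgeHDirection
import Literature.AlgebraicGeometry.HodgeTheory.HyperplaneSectionFamilyGoodFibres
import Literature.AlgebraicGeometry.HodgeTheory.LefschetzOneOneHolds
import Literature.AlgebraicGeometry.HodgeTheory.HodgeGenericQbarDescentFiniteMonodromyInputs
import Literature.AlgebraicGeometry.HodgeTheory.HyperplaneClassRational
import HarnessLib

/-!
# Thomas's hyperplane descent `V₂(n−1) ⇒ V₂(n)` (`n ≥ 5`), the `s`-direction: stub `stub_thomasDescentOfSweep`

Support file for the line `polar-patch-broken-cycles` of crux `VariationalHodge`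
(`Summit.HodgeConjecture.HodgeConjecture.Theses.AnchorTransport.VariationalHodge`), registered stub
`stub_thomasDescentOfSweep` (skeleton `Cruxes/VariationalHodge/Lines/polar_patch_broken_cycles.lean`).

* `vhcTwo_succ_of_vhcTwo_of_sweep` — the descent step: given the pencil SWEEP (landed
  `Theorems.stub_pencilSweep`) and `V₂(n)` for quasi-projective families over smooth irreducible affine
  bases, `V₂(n+1)` holds (`n ≥ 4`). The `s`-direction is the family `g : 𝒴 ⟶ S × (ℙᴺ)^*` of ALL
  hyperplane sections of ALL fibres (`Literature/…/UniversalHyperplaneSectionFamily…`): over its good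
  locus `G` it is a smooth projective family of `n`-folds with quasi-projective total space, anchored
  at a good section of `X_{s₀}` (`HodgeTheory.SectionFamily.map_fiberι_toX_mem_algebraicClasses_of_slice`),
  so `V₂(n)` (through `vhc_of_affine_fixed`) makes `A` algebraic on every good section `X_t ∩ H`; a good
  pencil of `X_s` through the generic-smoothness open has all its good members among them
  (`Motives.SectionFamily.pencil_smooth_and_members_iso`), and the SWEEP with Lefschetz `(1,1)` on
  `X_s` concludes.
* `stub_thomasDescentOfSweep` — the registered signature: induction on `n ≥ 5` from `V₂(4)`; the
  `H`-direction hypothesis is not needed on this route.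

## References

* [Thomas2005Nodes] R. P. Thomas, Nodes and the Hodge conjecture, J. Algebraic Geom. 14 (2005), §5.
* [VoisinHodgeII2003] C. Voisin, Hodge Theory and Complex Algebraic Geometry II, CUP 2003, §2.1.1.
-/

noncomputable section

set_option linter.dupNamespace false

open CategoryTheory CategoryTheory.Limits AlgebraicGeometry TopologicalSpace MonoidalCategory
  CartesianMonoidalCategory
open Literature.AlgebraicGeometry.Motives Literature.AlgebraicGeometry.HodgeTheory
open Literature.AlgebraicGeometry.Motives.UniversalHyperplaneSection
open Literature.AlgebraicGeometry.Motives.SectionFamily Literature.AlgebraicGeometry.HodgeTheory.SectionFamily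
open Summit.HodgeConjecture.HodgeConjecture.Theses.AnchorTransport

namespace Summit.HodgeConjecture.HodgeConjecture.Theorems

section ThomasStep

/-- **Thomas's hyperplane descent step `V₂(n) ⇒ V₂(n+1)` (`n ≥ 4`), the `s`-direction included.**
Given a smooth projective family `f : 𝒳 ⟶ S` of `(n+1)`-folds over a smooth irreducible affine base
with quasi-projective total space, a fibrewise rational `(2,2)` class `A` algebraic on `X_{s₀}`, and a
target `s`: embed `𝒳 ↪ ℙᴺ × S` (`exists_isClosedImmersion_of_isSmoothProjectiveFamily`), form the
family `g : 𝒴 ⟶ S × (ℙᴺ)^*` of all hyperplane sections of all fibres and its good locus `G`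
(`exists_goodLocus`); over `G` it is a smooth projective family of `n`-folds
(`isSmoothProjective_fiberOver_of_mem_goodLocus`, `isSmoothProjectiveFamily_snd_openSubschemeOverι`)
with quasi-projective total space, and `toX^* A` is anchored at a good section of `X_{s₀}`
(`map_fiberι_toX_mem_algebraicClasses_of_slice`); `V₂(n)` (through `vhc_of_affine_fixed`) makes
`A` algebraic on every good section `X_t ∩ H`; finally a good pencil of `X_s` through the
generic-smoothness open (`exists_pencil_through_open`, `pencil_smooth_and_members_iso`) has all its good
members among these sections, and the pencil SWEEP (with Lefschetz `(1,1)` on `X_s`) concludes.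
[cite: Thomas2005Nodes, §5] [cite: VoisinHodgeII2003, §2.1.1] -/
theorem vhcTwo_succ_of_vhcTwo_of_sweep {n : ℕ} (hn : 4 ≤ n)
    (hSweep : ∀ {m N : ℕ} {X : SchemeOver ℂ}, IsSmoothProjective (m + 1) X →
      ∀ (ι : X ⟶ projectiveSpace N ℂ) [IsClosedImmersion ι.left] {a : Fin (1 + 1) → Fin (N + 1) → ℂ}, a ≠ 0 →
      IsSmoothProjective (m + 1) (LinearSectionNet.total ι a) → ∀ {T : Set (projectiveSpace 1 ℂ).left},
      IsClosed T → T ≠ Set.univ →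
      (∀ s : ComplexPoints (projectiveSpace 1 ℂ), s.pt ∉ T → IsSmoothProjective m (fiberOver (LinearSectionNet.proj ι a) s)) →
      ∀ {q : ℕ}, 2 * (q + 1) ≤ m →
      (∀ c' : complexBetti X (2 * q), IsRationalClass c' → IsOfHodgeType (m + 1) X (2 * q) q q c' →
        c' ∈ algebraicClasses X q) →
      ∀ (c : complexBetti X (2 * (q + 1))),
      (∀ s : ComplexPoints (projectiveSpace 1 ℂ), s.pt ∉ T →
        complexBetti.map (fiberι (LinearSectionNet.proj ι a) s) (2 * (q + 1))
          (complexBetti.map (LinearSectionNet.blowDown ι a) (2 * (q + 1)) c) ∈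
          algebraicClasses (fiberOver (LinearSectionNet.proj ι a) s) (q + 1)) →
      c ∈ algebraicClasses X (q + 1))
    (hV : ∀ ⦃𝒳 S : SchemeOver ℂ⦄ (f : 𝒳 ⟶ S), IsSmoothProjectiveFamily f n → IsQuasiProjectiveOver 𝒳 →
      IrreducibleSpace S.left → IsAffine S.left → AlgebraicGeometry.Smooth S.hom →
      ∀ (A : complexBetti 𝒳 (2 * 2)),
      (∀ s : ComplexPoints S, IsRationalClass (complexBetti.map (fiberι f s) (2 * 2) A) ∧
        IsOfHodgeType n (fiberOver f s) (2 * 2) 2 2 (complexBetti.map (fiberι f s) (2 * 2) A)) →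
      (∃ s₀ : ComplexPoints S, complexBetti.map (fiberι f s₀) (2 * 2) A ∈ algebraicClasses (fiberOver f s₀) 2) →
      ∀ s : ComplexPoints S, complexBetti.map (fiberι f s) (2 * 2) A ∈ algebraicClasses (fiberOver f s) 2)
    ⦃𝒳 S : SchemeOver ℂ⦄ (f : 𝒳 ⟶ S) (hf : IsSmoothProjectiveFamily f (n + 1)) (h𝒳q : IsQuasiProjectiveOver 𝒳)
    (hSirr : IrreducibleSpace S.left) (hSaff : IsAffine S.left) (hSsm : AlgebraicGeometry.Smooth S.hom)
    (A : complexBetti 𝒳 (2 * 2))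
    (hA : ∀ s : ComplexPoints S, IsRationalClass (complexBetti.map (fiberι f s) (2 * 2) A) ∧
      IsOfHodgeType (n + 1) (fiberOver f s) (2 * 2) 2 2 (complexBetti.map (fiberι f s) (2 * 2) A))
    (hanchor : ∃ s₀ : ComplexPoints S, complexBetti.map (fiberι f s₀) (2 * 2) A ∈ algebraicClasses (fiberOver f s₀) 2)
    (s : ComplexPoints S) : complexBetti.map (fiberι f s) (2 * 2) A ∈ algebraicClasses (fiberOver f s) 2 := by
  obtain ⟨s₀, hs₀⟩ := hanchor
  haveI := hSirr
  haveI := hSaff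
  haveI := hSsm
  haveI : LocallyOfFiniteType S.hom := inferInstance
  haveI : IsSeparated S.hom := inferInstance
  obtain ⟨d, hd⟩ := exists_smoothOfRelativeDimension_of_smooth S.hom
  haveI := hd
  -- the embedding `e = ε ≫ pr : 𝒳 ⟶ ℙᴺ`, affine, a closed immersion on every fibre
  obtain ⟨N, ε, hεcl, hε⟩ := exists_isClosedImmersion_of_isSmoothProjectiveFamily hf h𝒳q
  haveI := hεcl
  haveI : IsAffineHom (ε ≫ fst (projectiveSpace N ℂ) S).left := isAffineHom_comp_fst_left ε
  have he : ∀ t : ComplexPoints S, IsClosedImmersion (fiberι f t ≫ ε ≫ fst (projectiveSpace N ℂ) S).left :=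
    fun t => isClosedImmersion_fiberι_comp_fst_left f ε hε t
  have hN : 2 ≤ N := by
    haveI := he s₀
    have h := le_of_isClosedImmersion_projectiveSpace (hf.isSmoothProjective s₀) (fiberι f s₀ ≫ ε ≫ fst (projectiveSpace N ℂ) S)
    omega
  -- the good locus and the family over it
  obtain ⟨G, hGsm, hGiff⟩ := exists_goodLocus f (ε ≫ fst (projectiveSpace N ℂ) S) hf (d := d) hN
  haveI := hGsm
  have hfib := isSmoothProjective_fiberOver_of_mem_goodLocus f (ε ≫ fst (projectiveSpace N ℂ) S) hf (d := d) hN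
    (by omega) he s₀ G hGsm hGiff
  haveI : IsProper (CartesianMonoidalCategory.lift (toX N (ε ≫ fst (projectiveSpace N ℂ) S) ≫ f)
      (proj N (ε ≫ fst (projectiveSpace N ℂ) S))).left := isProper_sectionFamily_left f _ hf
  have hF := isSmoothProjectiveFamily_snd_openSubschemeOverι
    (CartesianMonoidalCategory.lift (toX N (ε ≫ fst (projectiveSpace N ℂ) S) ≫ f) (proj N (ε ≫ fst (projectiveSpace N ℂ) S)))
    G hGsm hfib
  haveI : IsOpenImmersion (openSubschemeOverι (S ⊗ dualProjectiveSpace N ℂ) G).left := inferInstanceAs (IsOpenImmersion G.ι)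
  have hPq : IsQuasiProjectiveOver (dualProjectiveSpace N ℂ) :=
    IsQuasiProjectiveOver.of_isProjectiveOver (isSmoothProjective_projectiveSpace_holds ℂ N).isProjectiveOver
  have h𝒴q : IsQuasiProjectiveOver (universalHyperplaneSection N (ε ≫ fst (projectiveSpace N ℂ) S)) :=
    IsQuasiProjectiveOver.of_isClosedImmersion (emb N _) (isQuasiProjectiveOver_tensorObj_of_field h𝒳q hPq)
  have hq := isQuasiProjectiveOver_familyPullback
    (CartesianMonoidalCategory.lift (toX N (ε ≫ fst (projectiveSpace N ℂ) S) ≫ f) (proj N (ε ≫ fst (projectiveSpace N ℂ) S)))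
    (openSubschemeOverι (S ⊗ dualProjectiveSpace N ℂ) G) inferInstance h𝒴q
  -- the anchor: a good section of `X_{s₀}`
  obtain ⟨U₀, hU₀ne, hU₀⟩ := exists_open_forall_smooth_fiberOver_slice f (ε ≫ fst (projectiveSpace N ℂ) S) s₀ hf (d := d) hN
  haveI : LocallyOfFiniteType (dualProjectiveSpace N ℂ).hom := inferInstance
  obtain ⟨H₀, hH₀⟩ := exists_complexPoint_mem U₀ hU₀ne
  have hb₀G : AlgPoints.pt (CartesianMonoidalCategory.lift s₀ H₀ : ComplexPoints (S ⊗ dualProjectiveSpace N ℂ)) ∈ G :=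
    (hGiff _).mpr (hU₀ H₀ hH₀)
  have hanch := map_fiberι_toX_mem_algebraicClasses_of_slice f (ε ≫ fst (projectiveSpace N ℂ) S) hf (d := d) G hGsm hGiff
    hfib s₀ hs₀ U₀ hU₀ H₀ hH₀
  -- the base `G`: irreducible and smooth
  have hP := isSmoothProjective_projectiveSpace_holds ℂ N
  haveI := hP.smoothOfRelativeDimension
  haveI : Smooth (dualProjectiveSpace N ℂ).hom := SmoothOfRelativeDimension.smooth N _
  haveI : IrreducibleSpace (S ⊗ dualProjectiveSpace N ℂ).left := by
    haveI := hP.geometricallyIrreducible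
    haveI : UniversallyOpen (dualProjectiveSpace N ℂ).hom := inferInstance
    exact inferInstanceAs (IrreducibleSpace ↥(pullback S.hom (dualProjectiveSpace N ℂ).hom))
  have hBirr : IrreducibleSpace (openSubschemeOver (S ⊗ dualProjectiveSpace N ℂ) G).left := by
    change IrreducibleSpace G
    exact isIrreducible_iff_irreducibleSpace.mp ⟨⟨_, hb₀G⟩,
      (PreirreducibleSpace.isPreirreducible_univ (X := (S ⊗ dualProjectiveSpace N ℂ).left)).open_subset G.isOpen
        (Set.subset_univ _)⟩
  have hBsm : AlgebraicGeometry.Smooth (openSubschemeOver (S ⊗ dualProjectiveSpace N ℂ) G).hom := by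
    haveI := smooth_tensorObj_hom S (dualProjectiveSpace N ℂ)
    change AlgebraicGeometry.Smooth (G.ι ≫ (S ⊗ dualProjectiveSpace N ℂ).hom)
    infer_instance
  -- lifting the points of `G`
  have hrange : Set.range (AlgPoints.map (L := ℂ) (openSubschemeOverι (S ⊗ dualProjectiveSpace N ℂ) G)) = {P | P.pt ∈ G} := by
    rw [AlgPoints.range_map_of_isOpenImmersion_holds]
    ext P
    change P.pt ∈ G.ι.opensRange ↔ P.pt ∈ G
    rw [Scheme.Opens.opensRange_ι]
  -- the class `toX^* A` on the family over `G`, its fibre restrictions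
  set ct : complexBetti (universalHyperplaneSection N (ε ≫ fst (projectiveSpace N ℂ) S)) (2 * 2) :=
    complexBetti.map (toX N (ε ≫ fst (projectiveSpace N ℂ) S)) (2 * 2) A with hct
  have key : ∀ u : ComplexPoints (openSubschemeOver (S ⊗ dualProjectiveSpace N ℂ) G),
      complexBetti.map (fiberι (familyPullback.snd (CartesianMonoidalCategory.lift (toX N (ε ≫ fst (projectiveSpace N ℂ) S) ≫ f)
          (proj N (ε ≫ fst (projectiveSpace N ℂ) S))) (openSubschemeOverι (S ⊗ dualProjectiveSpace N ℂ) G)) u) (2 * 2)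
          (complexBetti.map (familyPullback.fst (CartesianMonoidalCategory.lift (toX N (ε ≫ fst (projectiveSpace N ℂ) S) ≫ f)
            (proj N (ε ≫ fst (projectiveSpace N ℂ) S))) (openSubschemeOverι (S ⊗ dualProjectiveSpace N ℂ) G)) (2 * 2) ct) ∈
          algebraicClasses (fiberOver (familyPullback.snd (CartesianMonoidalCategory.lift (toX N (ε ≫ fst (projectiveSpace N ℂ) S) ≫ f)
            (proj N (ε ≫ fst (projectiveSpace N ℂ) S))) (openSubschemeOverι (S ⊗ dualProjectiveSpace N ℂ) G)) u) 2 ↔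
        complexBetti.map (fiberι (CartesianMonoidalCategory.lift (toX N (ε ≫ fst (projectiveSpace N ℂ) S) ≫ f)
            (proj N (ε ≫ fst (projectiveSpace N ℂ) S)))
            (AlgPoints.map (openSubschemeOverι (S ⊗ dualProjectiveSpace N ℂ) G) u)) (2 * 2) ct ∈
          algebraicClasses (fiberOver (CartesianMonoidalCategory.lift (toX N (ε ≫ fst (projectiveSpace N ℂ) S) ≫ f)
            (proj N (ε ≫ fst (projectiveSpace N ℂ) S)))
            (AlgPoints.map (openSubschemeOverι (S ⊗ dualProjectiveSpace N ℂ) G) u)) 2 := by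
    intro u
    rw [map_fiberι_familyPullback]
    exact mem_algebraicClasses_map_iff_of_iso (fiberOverFamilyPullbackIso _ _ u)
  -- the fibre restrictions of `toX^* A` are restrictions of the `A|_{X_t}` along `Y_b ⟶ X_t`
  have hct_fib : ∀ b : ComplexPoints (S ⊗ dualProjectiveSpace N ℂ), b.pt ∈ G →
      IsRationalClass (complexBetti.map (fiberι (CartesianMonoidalCategory.lift (toX N (ε ≫ fst (projectiveSpace N ℂ) S) ≫ f)
        (proj N (ε ≫ fst (projectiveSpace N ℂ) S))) b) (2 * 2) ct) ∧
      IsOfHodgeType n (fiberOver (CartesianMonoidalCategory.lift (toX N (ε ≫ fst (projectiveSpace N ℂ) S) ≫ f)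
        (proj N (ε ≫ fst (projectiveSpace N ℂ) S))) b) (2 * 2) 2 2
        (complexBetti.map (fiberι (CartesianMonoidalCategory.lift (toX N (ε ≫ fst (projectiveSpace N ℂ) S) ≫ f)
          (proj N (ε ≫ fst (projectiveSpace N ℂ) S))) b) (2 * 2) ct) := by
    intro b hb
    obtain ⟨v, -, hv⟩ := exists_hom_fiberOver f (ε ≫ fst (projectiveSpace N ℂ) S) b
    rw [hct, ← CategoryTheory.comp_apply, ← complexBetti.map_comp, ← hv, complexBetti.map_comp,
      CategoryTheory.comp_apply]
    exact ⟨(hA _).1.map _, (hA _).2.map_of_isSmoothProjective (hfib b hb) (hf.isSmoothProjective _) v⟩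
  have hA' : ∀ u : ComplexPoints (openSubschemeOver (S ⊗ dualProjectiveSpace N ℂ) G),
      IsRationalClass (complexBetti.map (fiberι (familyPullback.snd (CartesianMonoidalCategory.lift (toX N (ε ≫ fst (projectiveSpace N ℂ) S) ≫ f)
          (proj N (ε ≫ fst (projectiveSpace N ℂ) S))) (openSubschemeOverι (S ⊗ dualProjectiveSpace N ℂ) G)) u) (2 * 2)
          (complexBetti.map (familyPullback.fst (CartesianMonoidalCategory.lift (toX N (ε ≫ fst (projectiveSpace N ℂ) S) ≫ f)
            (proj N (ε ≫ fst (projectiveSpace N ℂ) S))) (openSubschemeOverι (S ⊗ dualProjectiveSpace N ℂ) G)) (2 * 2) ct)) ∧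
        IsOfHodgeType n (fiberOver (familyPullback.snd (CartesianMonoidalCategory.lift (toX N (ε ≫ fst (projectiveSpace N ℂ) S) ≫ f)
            (proj N (ε ≫ fst (projectiveSpace N ℂ) S))) (openSubschemeOverι (S ⊗ dualProjectiveSpace N ℂ) G)) u) (2 * 2) 2 2
          (complexBetti.map (fiberι (familyPullback.snd (CartesianMonoidalCategory.lift (toX N (ε ≫ fst (projectiveSpace N ℂ) S) ≫ f)
            (proj N (ε ≫ fst (projectiveSpace N ℂ) S))) (openSubschemeOverι (S ⊗ dualProjectiveSpace N ℂ) G)) u) (2 * 2)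
            (complexBetti.map (familyPullback.fst (CartesianMonoidalCategory.lift (toX N (ε ≫ fst (projectiveSpace N ℂ) S) ≫ f)
              (proj N (ε ≫ fst (projectiveSpace N ℂ) S))) (openSubschemeOverι (S ⊗ dualProjectiveSpace N ℂ) G)) (2 * 2) ct)) := by
    intro u
    have hmem : (AlgPoints.map (openSubschemeOverι (S ⊗ dualProjectiveSpace N ℂ) G) u).pt ∈ G := by
      have h : AlgPoints.map (openSubschemeOverι (S ⊗ dualProjectiveSpace N ℂ) G) u ∈
          Set.range (AlgPoints.map (L := ℂ) (openSubschemeOverι (S ⊗ dualProjectiveSpace N ℂ) G)) := ⟨u, rfl⟩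
      rw [hrange] at h
      exact h
    obtain ⟨hr, hh⟩ := hct_fib _ hmem
    rw [map_fiberι_familyPullback]
    exact ⟨hr.map _, hh.map_of_isSmoothProjective (hF.isSmoothProjective u) (hfib _ hmem) _⟩
  -- `V₂(n)` over `G`, from the anchor
  obtain ⟨u₀, hu₀⟩ : (CartesianMonoidalCategory.lift s₀ H₀ : ComplexPoints (S ⊗ dualProjectiveSpace N ℂ)) ∈
      Set.range (AlgPoints.map (L := ℂ) (openSubschemeOverι (S ⊗ dualProjectiveSpace N ℂ) G)) := by
    rw [hrange]; exact hb₀G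
  have hall := vhc_of_affine_fixed hV _ hF hq hBirr hBsm _ hA' ⟨u₀, (key u₀).2 (by rw [hu₀]; exact hanch)⟩
  have halgG : ∀ b : ComplexPoints (S ⊗ dualProjectiveSpace N ℂ), b.pt ∈ G →
      complexBetti.map (fiberι (CartesianMonoidalCategory.lift (toX N (ε ≫ fst (projectiveSpace N ℂ) S) ≫ f)
        (proj N (ε ≫ fst (projectiveSpace N ℂ) S))) b) (2 * 2) ct ∈
        algebraicClasses (fiberOver (CartesianMonoidalCategory.lift (toX N (ε ≫ fst (projectiveSpace N ℂ) S) ≫ f)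
          (proj N (ε ≫ fst (projectiveSpace N ℂ) S))) b) 2 := by
    intro b hb
    obtain ⟨u, rfl⟩ : b ∈ Set.range (AlgPoints.map (L := ℂ) (openSubschemeOverι (S ⊗ dualProjectiveSpace N ℂ) G)) := by
      rw [hrange]; exact hb
    exact (key u).1 (hall u)
  -- the target fibre `X_s`: a good pencil through the generic-smoothness open
  obtain ⟨U, hUne, hU⟩ := exists_open_forall_smooth_fiberOver_slice f (ε ≫ fst (projectiveSpace N ℂ) S) s hf (d := d) hN
  haveI := he s
  obtain ⟨a, ha₀, hminor, hXta, hconn, haU⟩ := exists_pencil_through_open (hf.isSmoothProjective s)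
    (fiberι f s ≫ ε ≫ fst (projectiveSpace N ℂ) S) (by omega) (by omega) U hUne
  obtain ⟨Λ, hΛ⟩ := exists_lineMap a hminor
  haveI := hconn
  obtain ⟨-, hmem⟩ := pencil_smooth_and_members_iso f (ε ≫ fst (projectiveSpace N ℂ) S) s Λ hf (d := d) hN a hXta hΛ U hU
  have ha : a ≠ 0 := fun h => ha₀ (by rw [h]; rfl)
  -- the bad set `T = ℙ¹ ∖ Λ⁻¹ U`
  have h01 : (![0, 1] : Fin (1 + 1) → ℂ) ≠ 0 := fun h => by
    have h1 := congrFun h 1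
    simp only [Matrix.cons_val_one, Pi.zero_apply] at h1
    exact one_ne_zero h1
  obtain ⟨hc, hΛ01⟩ := hΛ ![0, 1] h01
  have hl0 : (ProjectiveSpace.pointOfVec ℂ ![0, 1] h01).pt ∈ Λ.left ⁻¹ᵁ U := by
    change Λ.left.base (ProjectiveSpace.pointOfVec ℂ ![0, 1] h01).pt ∈ U
    rw [← AlgPoints.pt_map, hΛ01]
    convert haU using 3
    funext i
    simp
  have hT : IsClosed ((Λ.left ⁻¹ᵁ U : Set (projectiveSpace 1 ℂ).left)ᶜ) := (Λ.left ⁻¹ᵁ U).isOpen.isClosed_compl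
  have hTne : ((Λ.left ⁻¹ᵁ U : Set (projectiveSpace 1 ℂ).left)ᶜ) ≠ Set.univ := fun h => by
    have : (ProjectiveSpace.pointOfVec ℂ ![0, 1] h01).pt ∈ ((Λ.left ⁻¹ᵁ U : Set (projectiveSpace 1 ℂ).left)ᶜ) :=
      h ▸ Set.mem_univ _
    exact this hl0
  have hfibT : ∀ lam : ComplexPoints (projectiveSpace 1 ℂ), lam.pt ∉ ((Λ.left ⁻¹ᵁ U : Set (projectiveSpace 1 ℂ).left)ᶜ) →
      IsSmoothProjective n (fiberOver (LinearSectionNet.proj (fiberι f s ≫ ε ≫ fst (projectiveSpace N ℂ) S) a) lam) :=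
    fun lam hlam => (hmem lam (Set.notMem_compl_iff.mp hlam)).1
  -- every good member carries an algebraic restriction: it is a good section of `X_s`
  have hres : ∀ lam : ComplexPoints (projectiveSpace 1 ℂ), lam.pt ∉ ((Λ.left ⁻¹ᵁ U : Set (projectiveSpace 1 ℂ).left)ᶜ) →
      complexBetti.map (fiberι (LinearSectionNet.proj (fiberι f s ≫ ε ≫ fst (projectiveSpace N ℂ) S) a) lam) (2 * (1 + 1))
        (complexBetti.map (LinearSectionNet.blowDown (fiberι f s ≫ ε ≫ fst (projectiveSpace N ℂ) S) a) (2 * (1 + 1))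
          (complexBetti.map (fiberι f s) (2 * 2) A)) ∈
        algebraicClasses (fiberOver (LinearSectionNet.proj (fiberι f s ≫ ε ≫ fst (projectiveSpace N ℂ) S) a) lam) (1 + 1) := by
    intro lam hlam
    have hlam' := Set.notMem_compl_iff.mp hlam
    obtain ⟨-, ψ, hψ⟩ := hmem lam hlam'
    have hbG : (AlgPoints.map (Λ ≫ CartesianMonoidalCategory.lift (toSpecOver (dualProjectiveSpace N ℂ) ≫ s)
        (𝟙 (dualProjectiveSpace N ℂ))) lam).pt ∈ G := by
      rw [hGiff, AlgPoints.map_comp_apply, map_slice]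
      exact hU _ hlam'
    have h := (mem_algebraicClasses_map_iff_of_iso ψ).mpr (halgG _ hbG)
    rw [hct, ← CategoryTheory.comp_apply, ← complexBetti.map_comp, ← CategoryTheory.comp_apply,
      ← complexBetti.map_comp] at h
    simp only [Category.assoc] at h
    rw [hψ] at h
    rw [← CategoryTheory.comp_apply, ← complexBetti.map_comp, ← CategoryTheory.comp_apply, ← complexBetti.map_comp]
    simpa only [Category.assoc] using h
  exact hSweep (hf.isSmoothProjective s) (fiberι f s ≫ ε ≫ fst (projectiveSpace N ℂ) S) ha hXta hT hTne hfibT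
    (q := 1) (by omega) (lefschetzOneOne_rational_holds (hf.isSmoothProjective s)) _ hres

/-- **Registered stub `stub_thomasDescentOfSweep` of the line `polar-patch-broken-cycles`** (skeleton
`Cruxes/VariationalHodge/Lines/polar_patch_broken_cycles.lean`): Thomas's descent `V₂(n)` for all
`n ≥ 5` from the pencil SWEEP, (the `H`-direction, unused) and `V₂(4)`, by induction on `n`
(`vhcTwo_succ_of_vhcTwo_of_sweep`). [cite: Thomas2005Nodes, §5] -/
theorem stub_thomasDescentOfSweep : (∀ {m N : ℕ} {X : SchemeOver ℂ}, IsSmoothProjective (m + 1) X →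
      ∀ (ι : X ⟶ projectiveSpace N ℂ) [IsClosedImmersion ι.left] {a : Fin (1 + 1) →
      Fin (N + 1) →
      ℂ}, a ≠ 0 →
      IsSmoothProjective (m + 1) (LinearSectionNet.total ι a) →
      ∀ {T : Set (projectiveSpace 1 ℂ).left}, IsClosed T →
      T ≠ Set.univ →
      (∀ s : ComplexPoints (projectiveSpace 1 ℂ), s.pt ∉ T →
      IsSmoothProjective m (fiberOver (LinearSectionNet.proj ι a) s)) →
      ∀ {q : ℕ}, 2 * (q + 1) ≤ m →
      (∀ c' : complexBetti X (2 * q), IsRationalClass c' →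
      IsOfHodgeType (m + 1) X (2 * q) q q c' →
      c' ∈ algebraicClasses X q) →
      ∀ (c : complexBetti X (2 * (q + 1))), (∀ s : ComplexPoints (projectiveSpace 1 ℂ), s.pt ∉ T →
      complexBetti.map (fiberι (LinearSectionNet.proj ι a) s) (2 * (q + 1)) (complexBetti.map (LinearSectionNet.blowDown ι a) (2 * (q + 1)) c) ∈ algebraicClasses (fiberOver (LinearSectionNet.proj ι a) s) (q + 1)) →
      c ∈ algebraicClasses X (q + 1)) →
      (∀ {m N : ℕ} {X : SchemeOver ℂ}, IsSmoothProjective (m + 1) X →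
      (∀ ⦃𝒳 S : SchemeOver ℂ⦄ (f : 𝒳 ⟶ S), IsSmoothProjectiveFamily f m →
      IsQuasiProjectiveOver 𝒳 →
      IrreducibleSpace S.left →
      IsAffine S.left →
      AlgebraicGeometry.Smooth S.hom →
      ∀ (A : complexBetti 𝒳 (2 * 2)), (∀ s : ComplexPoints S, IsRationalClass (complexBetti.map (fiberι f s) (2 * 2) A) ∧ IsOfHodgeType m (fiberOver f s) (2 * 2) 2 2 (complexBetti.map (fiberι f s) (2 * 2) A)) →
      (∃ s₀ : ComplexPoints S, complexBetti.map (fiberι f s₀) (2 * 2) A ∈ algebraicClasses (fiberOver f s₀) 2) →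
      ∀ s : ComplexPoints S, complexBetti.map (fiberι f s) (2 * 2) A ∈ algebraicClasses (fiberOver f s) 2) →
      ∀ (ι : X ⟶ projectiveSpace N ℂ) [IsClosedImmersion ι.left] (a : Fin (1 + 1) →
      Fin (N + 1) →
      ℂ), IsSmoothProjective (m + 1) (LinearSectionNet.total ι a) →
      ∀ (V : (projectiveSpace 1 ℂ).left.Opens), SmoothOfRelativeDimension m ((LinearSectionNet.proj ι a).left ∣_ V) →
      (∀ t : ComplexPoints (projectiveSpace 1 ℂ), t.pt ∈ V →
      IsSmoothProjective m (fiberOver (LinearSectionNet.proj ι a) t)) →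
      ∀ (c : complexBetti X (2 * 2)), IsRationalClass c →
      IsOfHodgeType (m + 1) X (2 * 2) 2 2 c →
      ∀ {t₁ : ComplexPoints (projectiveSpace 1 ℂ)}, t₁.pt ∈ V →
      complexBetti.map (fiberι (LinearSectionNet.proj ι a) t₁) (2 * 2) (complexBetti.map (LinearSectionNet.blowDown ι a) (2 * 2) c) ∈ algebraicClasses (fiberOver (LinearSectionNet.proj ι a) t₁) 2 →
      ∀ (t : ComplexPoints (projectiveSpace 1 ℂ)), t.pt ∈ V →
      complexBetti.map (fiberι (LinearSectionNet.proj ι a) t) (2 * 2) (complexBetti.map (LinearSectionNet.blowDown ι a) (2 * 2) c) ∈ algebraicClasses (fiberOver (LinearSectionNet.proj ι a) t) 2) →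
      (∀ ⦃𝒳 S : SchemeOver ℂ⦄ (f : 𝒳 ⟶ S), IsSmoothProjectiveFamily f 4 →
      IsQuasiProjectiveOver 𝒳 →
      IrreducibleSpace S.left →
      IsAffine S.left →
      AlgebraicGeometry.Smooth S.hom →
      ∀ (A : complexBetti 𝒳 (2 * 2)), (∀ s : ComplexPoints S, IsRationalClass (complexBetti.map (fiberι f s) (2 * 2) A) ∧ IsOfHodgeType 4 (fiberOver f s) (2 * 2) 2 2 (complexBetti.map (fiberι f s) (2 * 2) A)) →
      (∃ s₀ : ComplexPoints S, complexBetti.map (fiberι f s₀) (2 * 2) A ∈ algebraicClasses (fiberOver f s₀) 2) →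
      ∀ s : ComplexPoints S, complexBetti.map (fiberι f s) (2 * 2) A ∈ algebraicClasses (fiberOver f s) 2) →
      ∀ n : ℕ, 5 ≤ n →
      ∀ ⦃𝒳 S : SchemeOver ℂ⦄ (f : 𝒳 ⟶ S), IsSmoothProjectiveFamily f n →
      IsQuasiProjectiveOver 𝒳 →
      IrreducibleSpace S.left →
      IsAffine S.left →
      AlgebraicGeometry.Smooth S.hom →
      ∀ (A : complexBetti 𝒳 (2 * 2)), (∀ s : ComplexPoints S, IsRationalClass (complexBetti.map (fiberι f s) (2 * 2) A) ∧ IsOfHodgeType n (fiberOver f s) (2 * 2) 2 2 (complexBetti.map (fiberι f s) (2 * 2) A)) →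
      (∃ s₀ : ComplexPoints S, complexBetti.map (fiberι f s₀) (2 * 2) A ∈ algebraicClasses (fiberOver f s₀) 2) →
      ∀ s : ComplexPoints S, complexBetti.map (fiberι f s) (2 * 2) A ∈ algebraicClasses (fiberOver f s) 2 := by
  intro hSweep _hH hV4 n hn
  induction n, hn using Nat.le_induction with
  | base => exact vhcTwo_succ_of_vhcTwo_of_sweep (n := 4) le_rfl hSweep hV4
  | succ m hm ih => exact vhcTwo_succ_of_vhcTwo_of_sweep (n := m) (by omega) hSweep ih

end ThomasStep

end Summit.HodgeConjecture.HodgeConjecture.Theorems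

end
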